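import Summits.BirchSwinnertonDyer.BirchSwinnertonDyer.Theorems.SmallImageMuTransferMuTransferX9KolyvaginValueDivision
import HarnessLib

/-!
# Route ByReductionTypeAtTwo, crux `OrdKatoHalfAtTwoIso` (stmt-BirchSwinnertonDyer-19573), line `steinberg-fibre-at-two`,
# registered stub `stub_HK_kolyvaginRankOneTwo` (Ω2 = H-K), interior step K3: the VALUE LINE at a TRANSPOSITION prime, `p = 2`

Seat `cruxlead-stmt-BirchSwinnertonDyer-19573-g0` (LEAD PROVER, MODE LINE; HOME `run/shared/lean/pub/bsd-2adic/`).
THEOREMS ONLY (pure algebra on `Fin L → M` with `2·M = 0`; no definition, no named fact, no `sorry`). HONEST FRAMING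
(cell bsd-2adic): BSD is not proved by any of this; the crux is not proved; this is a `--supports` helper toward the
lead's registered research stub `stub_HK_kolyvaginRankOneTwo : KolyvaginRankOneTwo` (skeleton v5), closing nothing.

WHAT. The `p = 2` twin of the odd kernel's division step `KolyvaginTwist.neg_castLE_eq_shiftEnd_pow_aeval_castLE` /
`exists_poly_neg_castLE_eq_of_keyRelation` (`Theorems/SmallImageMuTransferMuTransferX9KolyvaginValueDivision.lean`,
`…KolyvaginValueAssembled.lean`) when the Frobenius at the Kolyvagin prime is NOT `E`-split but a TRANSPOSITION `τ`
(`τ² = 1`) on `M = E[2]`: on `𝒯_L = M ⊗ 𝔽₂[T]/(T^L)` it acts as `φ̃ ∘ τ` with `φ̃ = (1+S)^{2ᵐu}` (`u` odd, `m` the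
depth), so the operator `N := φ̃τ − 1` of the key relation `N·a' = −(φ̃ − 1)²·t₁` (norm witness `a'` against the
Euler-factor side `P̄(φ̃) = (φ̃ − 1)²`, `P̄ ≡ (1 − X)²`) is no longer the scalar `φ̃ − 1`. The stub-critic's F4
(`Cruxes/OrdKatoHalfAtTwoIso/STUB-PLAN-stub_port.md`, `CriticChecksAtTwo.lean` `N_sq`/`ker_N_le`) observed that in
characteristic `2` nevertheless `N² = (φ̃ − 1)²` (K3a below), whence `(φ̃ − 1)²·(a' + N t₁) = 0` (K3b), and since
`(φ̃ − 1)² = S^{2^{m+1}}·(unit)` the truncation to any level `J` with `J + 2^{m+1} ≤ L` gives the value EXACTLY: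
`−(a' mod T^J) = N_J (t₁ mod T^J)`, and `N_J = τ − 1` as soon as `J ≤ 2ᵐ` (K3c–K3d). With the coboundary correction
`t₁ mod T^J = S^{a₀} v + (τ − 1) b` (the level-`J` action of the Frobenius is `τ`) and `(τ − 1)² = 0` this is the
rank-one value `−(a' mod T^J) = S^{a₀}(τ v − v)` consumed by `KolyvaginRankOneTwo` (K3e).

References: B. Mazur, K. Rubin, Mem. AMS 799 (2004) §1.2 and Prop. 1.3.2 [MazurRubin2004]; K. Rubin, *Euler Systems*
(2000) Lemma 4.4.2, Thm. 4.5.4 [Rubin2000]; L. Washington, *Introduction to Cyclotomic Fields* (1997) §13.2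
[Washington1997]; B. Perrin-Riou, Ann. Inst. Fourier 48 (1998) Prop. 3.1.6 [PerrinRiou1998AIF].
-/

set_option linter.dupNamespace false
set_option autoImplicit false

noncomputable section

open Function Polynomial
open Literature.NumberTheory.EllipticCurves
open Summit.BirchSwinnertonDyer.BirchSwinnertonDyer.Rank1Residual.KolyvaginTwist

namespace Summit.BirchSwinnertonDyer.BirchSwinnertonDyer.Theorems.SteinbergFibreAtTwo.KThree

variable {M : Type*} [AddCommGroup M]

/-! ## §1 `2 = 0` in the endomorphism ring -/

/-- On a module killed by `2`, `2 = 0` in `End(Fin L → M)`. [folklore] -/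
theorem two_eq_zero_moduleEnd (hM : ∀ x : M, 2 • x = 0) (L : ℕ) : (2 : Module.End ℤ (Fin L → M)) = 0 := by
  refine LinearMap.ext fun x => funext fun i => ?_
  have h := Module.End.natCast_apply (R := ℤ) (M := Fin L → M) 2 x
  rw [Nat.cast_ofNat] at h
  rw [h, LinearMap.zero_apply, Pi.smul_apply, Pi.zero_apply, hM]

/-- On a module killed by `2`, `−x = x` coordinatewise on `Fin L → M`. [folklore] -/
theorem neg_eq_self_of_two_nsmul (hM : ∀ x : M, 2 • x = 0) {L : ℕ} (x : Fin L → M) : -x = x := by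
  funext i
  rw [Pi.neg_apply, neg_eq_iff_add_eq_zero, ← two_nsmul]
  exact hM (x i)

/-! ## §2 K3a: `N² = (φ̃ − 1)²` for `N = φ̃τ − 1`, `τ² = 1`, in characteristic `2` -/

/-- **K3a (`N² = (φ̃ − 1)²`, the critic's `N_sq`).** On `Fin L → M` with `2·M = 0`, for a coordinatewise involution
`τ` (`τ² = 1` on `M`) and any unipotent `φ̃ = (1+S)^c`: `(φ̃τ − 1)² = (φ̃ − 1)²` (both equal `φ̃² + 1`; the cross
terms carry a factor `2`). [cite: MazurRubin2004, §1.2 (the operator `Fr_ℓ − 1` on `T ⊗ Λ`)] -/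
theorem frobOp_mul_self (hM : ∀ x : M, 2 • x = 0) {L : ℕ} (τ : M →ₗ[ℤ] M) (hτ : τ * τ = 1) (c : ℕ) :
    (unipotentPow M L c * τ.compLeft (Fin L) - 1) * (unipotentPow M L c * τ.compLeft (Fin L) - 1) =
      (unipotentPow M L c - 1) * (unipotentPow M L c - 1) := by
  set F := unipotentPow M L c with hF
  set T := τ.compLeft (Fin L) with hT
  have hTT : T * T = 1 := by
    rw [hT, ← ZpExtension.compLeft_mul, hτ]
    rfl
  have hFT : F * T = T * F := ZpExtension.unipotentPow_mul_compLeft c τ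
  have h2 := two_eq_zero_moduleEnd hM L
  have hsq : F * T * (F * T) = F * F := by
    rw [mul_assoc, ← mul_assoc T F T, ← hFT, mul_assoc, hTT, mul_one]
  -- expand both squares
  have lhs : (F * T - 1) * (F * T - 1) = F * F - 2 * (F * T) + 1 := by
    rw [sub_mul, mul_sub, one_mul, mul_one, hsq, two_mul]; abel
  have rhs : (F - 1) * (F - 1) = F * F - 2 * F + 1 := by
    rw [sub_mul, mul_sub, one_mul, mul_one, two_mul]; abel
  rw [lhs, rhs, h2, zero_mul, zero_mul]

/-! ## §3 K3b: the key relation multiplied by `N` -/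

/-- **K3b.** If `N a' = −(φ̃ − 1)((φ̃ − 1) t₁)` with `N = φ̃τ − 1` as in K3a (the norm-witness key relation of the
Kolyvagin cocycle at a transposition prime, Euler factor `P̄(φ̃) = (φ̃ − 1)²`), then
`(φ̃ − 1)((φ̃ − 1)(a' + N t₁)) = 0` (apply `N`, use `N² = (φ̃ − 1)²` and that `N` commutes with `φ̃ − 1`).
[cite: MazurRubin2004, Prop. 1.3.2] [cite: Rubin2000, Thm. 4.5.4] -/
theorem sub_one_sub_one_apply_add_eq_zero (hM : ∀ x : M, 2 • x = 0) {L : ℕ} (τ : M →ₗ[ℤ] M)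
    (hτ : τ * τ = 1) (c : ℕ) (a' t₁ : Fin L → M)
    (hkey : (unipotentPow M L c * τ.compLeft (Fin L) - 1) a' =
      -((unipotentPow M L c - 1) ((unipotentPow M L c - 1) t₁))) :
    (unipotentPow M L c - 1) ((unipotentPow M L c - 1)
      (a' + (unipotentPow M L c * τ.compLeft (Fin L) - 1) t₁)) = 0 := by
  set F := unipotentPow M L c with hF
  set T := τ.compLeft (Fin L) with hT
  set N := F * T - 1 with hN
  have hFT : F * T = T * F := ZpExtension.unipotentPow_mul_compLeft c τ
  -- `N` commutes with `F - 1` (`F T` commutes with `F`)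
  have hc : Commute (F * T) F := by
    change F * T * F = F * (F * T)
    rw [mul_assoc, ← hFT]
  have hcomm : N * (F - 1) = (F - 1) * N :=
    ((hc.sub_right (Commute.one_right _)).sub_left (Commute.one_left _)).eq
  have hNN : N * N = (F - 1) * (F - 1) := frobOp_mul_self hM τ hτ c
  -- apply `N` to the key relation
  have h1 : (N * N) a' = -((N * ((F - 1) * (F - 1))) t₁) := by
    rw [Module.End.mul_apply, hkey, map_neg, Module.End.mul_apply, Module.End.mul_apply]
  rw [hNN, ← mul_assoc, hcomm, mul_assoc, hcomm, ← mul_assoc] at h1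
  -- `h1 : ((F-1)(F-1)) a' = -(((F-1)(F-1) N) t₁)`
  change ((F - 1) * (F - 1)) (a' + N t₁) = 0
  rw [map_add, h1, Module.End.mul_apply ((F - 1) * (F - 1)) N t₁, neg_add_cancel]

/-! ## §4 K3c: `(φ̃ − 1)² x = 0` truncates to `x ≡ 0 (mod T^{L − 2^{m+1}})` -/

/-- **K3c (the critic's `ker_N_le` in level form).** For `φ̃ = (1+S)^{2ᵐu}` with `u` odd on `Fin L → M` (`2·M = 0`):
if `(φ̃ − 1)((φ̃ − 1) x) = 0` then `x mod T^J = 0` for every `J` with `J + 2^{m+1} ≤ L` (`φ̃ − 1 = S^{2ᵐ}·V(S)`,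
`V(0) = u` a unit, so `(φ̃ − 1)² = S^{2^{m+1}}·unit`). Two applications of the odd kernel's one-step division
`castLE_eq_neg_castLE_of_sub_one_apply_eq`. [cite: Washington1997, §13.2 (arithmetic in Λ/(p, T^n))] -/
theorem castLE_eq_zero_of_sub_one_sub_one_apply_eq_zero (hM : ∀ x : M, 2 • x = 0) (m u : ℕ) (hu : ¬ 2 ∣ u)
    {L J : ℕ} (hJL : J + 2 ^ (m + 1) ≤ L) (x : Fin L → M)
    (hx : (unipotentPow M L (2 ^ m * u) - 1) ((unipotentPow M L (2 ^ m * u) - 1) x) = 0) :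
    (fun i : Fin J => x (Fin.castLE (le_trans (Nat.le_add_right J (2 ^ (m + 1))) hJL) i)) = 0 := by
  haveI : Fact (2 : ℕ).Prime := ⟨Nat.prime_two⟩
  obtain ⟨k, hk⟩ : ∃ k, 2 ^ m = k := ⟨_, rfl⟩
  have hk2 : 2 ^ (m + 1) = k + k := by rw [pow_succ, hk]; ring
  -- first division at level `L`: `(φ̃ − 1) x ≡ 0 (mod T^{J + 2^m})`
  have hJ1 : (J + k) + 2 ^ m ≤ L := by rw [hk]; omega
  have hrel1 : (unipotentPow M L (2 ^ m * u) - 1) ((unipotentPow M L (2 ^ m * u) - 1) x) =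
      -((unipotentPow M L (2 ^ m * u) - 1) 0) := by rw [hx, map_zero, neg_zero]
  have h1 := castLE_eq_neg_castLE_of_sub_one_apply_eq hM m u hu hJ1 _ 0 hrel1
  simp only [Pi.zero_apply, neg_zero] at h1
  -- rewrite through truncation: the truncation of `(φ̃ − 1) x` is `(φ̃ − 1)` of the truncation
  have hJkL : J + k ≤ L := by omega
  have htr : (fun i : Fin (J + k) => ((unipotentPow M L (2 ^ m * u) - 1) x) (Fin.castLE hJkL i)) =
      (unipotentPow M (J + k) (2 ^ m * u) - 1) (fun i => x (Fin.castLE hJkL i)) := by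
    rw [LinearMap.sub_apply, LinearMap.sub_apply, Module.End.one_apply, Module.End.one_apply,
      ← ZpExtension.unipotentPow_comp_castLE]
    rfl
  have h1' : (unipotentPow M (J + k) (2 ^ m * u) - 1) (fun i => x (Fin.castLE hJkL i)) = fun _ => 0 := by
    rw [← htr]; exact h1
  -- second division at level `J + 2^m`
  have hJ2 : J + 2 ^ m ≤ J + k := by rw [hk]
  have hrel2 : (unipotentPow M (J + k) (2 ^ m * u) - 1) (fun i => x (Fin.castLE hJkL i)) =
      -((unipotentPow M (J + k) (2 ^ m * u) - 1) (0 : Fin (J + k) → M)) := by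
    rw [h1', map_zero, neg_zero]; rfl
  have h2 := castLE_eq_neg_castLE_of_sub_one_apply_eq hM m u hu hJ2 _ 0 hrel2
  simp only [Pi.zero_apply, neg_zero] at h2
  funext i
  exact congrFun h2 i

/-! ## §5 K3d: the value modulo `T^J` -/

/-- Truncation commutes with a coordinatewise operator. [folklore] -/
theorem compLeft_comp_castLE {L J : ℕ} (hJL : J ≤ L) (τ : M →ₗ[ℤ] M) (x : Fin L → M) :
    (fun i : Fin J => τ.compLeft (Fin L) x (Fin.castLE hJL i)) = τ.compLeft (Fin J) (fun i => x (Fin.castLE hJL i)) :=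
  rfl

/-- **K3d (the value line at a transposition prime, level form).** From the key relation
`(φ̃τ − 1) a' = −(φ̃ − 1)² t₁` at level `L`, `φ̃ = (1+S)^{2ᵐu}`, `u` odd, `τ² = 1`, and `J ≤ 2ᵐ`, `J + 2^{m+1} ≤ L`:
`−(a' mod T^J) = τ (t₁ mod T^J) − (t₁ mod T^J)` (at level `J ≤ 2ᵐ` the unipotent factor is `1`, so `N_J = τ − 1`).
[cite: MazurRubin2004, Prop. 1.3.2] [cite: Rubin2000, Lemma 4.4.2 and Thm. 4.5.4] -/
theorem neg_castLE_eq_compLeft_sub_of_keyRelation (hM : ∀ x : M, 2 • x = 0) (m u : ℕ) (hu : ¬ 2 ∣ u)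
    (τ : M →ₗ[ℤ] M) (hτ : τ * τ = 1) {L J : ℕ} (hJm : J ≤ 2 ^ m) (hJL : J + 2 ^ (m + 1) ≤ L)
    (a' t₁ : Fin L → M)
    (hkey : (unipotentPow M L (2 ^ m * u) * τ.compLeft (Fin L) - 1) a' =
      -((unipotentPow M L (2 ^ m * u) - 1) ((unipotentPow M L (2 ^ m * u) - 1) t₁))) :
    (fun i : Fin J => -a' (Fin.castLE (le_trans (Nat.le_add_right J (2 ^ (m + 1))) hJL) i)) =
      τ.compLeft (Fin J) (fun i => t₁ (Fin.castLE (le_trans (Nat.le_add_right J (2 ^ (m + 1))) hJL) i)) -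
        fun i => t₁ (Fin.castLE (le_trans (Nat.le_add_right J (2 ^ (m + 1))) hJL) i) := by
  haveI : Fact (2 : ℕ).Prime := ⟨Nat.prime_two⟩
  have h0 := castLE_eq_zero_of_sub_one_sub_one_apply_eq_zero hM m u hu hJL _
    (sub_one_sub_one_apply_add_eq_zero hM τ hτ (2 ^ m * u) a' t₁ hkey)
  -- `h0 : (a' + N t₁) mod T^J = 0`
  have hJL' : J ≤ L := le_trans (Nat.le_add_right J (2 ^ (m + 1))) hJL
  have hNJ : (fun i : Fin J => ((unipotentPow M L (2 ^ m * u) * τ.compLeft (Fin L) - 1) t₁) (Fin.castLE hJL' i)) =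
      τ.compLeft (Fin J) (fun i => t₁ (Fin.castLE hJL' i)) - fun i => t₁ (Fin.castLE hJL' i) := by
    have h1 : unipotentPow M J (2 ^ m * u) = 1 := unipotentPow_eq_one_of_dvd hM hJm (dvd_mul_right _ _)
    have : (fun i : Fin J => ((unipotentPow M L (2 ^ m * u) * τ.compLeft (Fin L)) t₁) (Fin.castLE hJL' i)) =
        τ.compLeft (Fin J) (fun i => t₁ (Fin.castLE hJL' i)) := by
      rw [Module.End.mul_apply, ZpExtension.unipotentPow_comp_castLE, compLeft_comp_castLE hJL', h1,
        Module.End.one_apply]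
    rw [← this]
    rfl
  funext i
  have hi := congrFun h0 i
  simp only [Pi.add_apply, Pi.zero_apply] at hi
  -- `hi : a' (castLE i) + (N t₁) (castLE i) = 0`
  have hi' := congrFun hNJ i
  -- `hi' : (N t₁) (castLE i) = (τ t − t) i`
  rw [← hi']
  exact neg_eq_iff_add_eq_zero.mpr hi

/-! ## §6 K3e: the coboundary correction and the rank-one value `S^{a₀}(τ v − v)` -/

/-- `(τ − 1)² = 0` on `Fin J → M` for a coordinatewise involution in characteristic `2`. [folklore] -/
theorem compLeft_sub_one_mul_self (hM : ∀ x : M, 2 • x = 0) {J : ℕ} (τ : M →ₗ[ℤ] M) (hτ : τ * τ = 1) :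
    (τ.compLeft (Fin J) - 1) * (τ.compLeft (Fin J) - 1) = 0 := by
  have h := frobOp_mul_self hM (L := J) τ hτ 0
  rwa [unipotentPow_zero, one_mul, sub_self, zero_mul] at h

/-- **K3e (the rank-one value).** Under the hypotheses of K3d, if moreover the truncation of `t₁` differs from
`S^{a₀} v` by a `τ`-coboundary, `t₁ mod T^J − S^{a₀} v = τ b − b` (the cocycles of `𝐳̄₁` and of `S^{a₀}κ'` are
cohomologous and the Frobenius acts on `𝒯_J` as `τ`), then `−(a' mod T^J) = S^{a₀}(τ v − v)`: the value of the
Kolyvagin cocycle at the tame generator is `T^{a₀}·(Fr − 1)·κ'(Fr)` — the line `u·(z̄₁(Fr))₂` of card #9.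
[cite: MazurRubin2004, Prop. 1.3.2] [cite: Rubin2000, Thm. 4.5.4] -/
theorem neg_castLE_eq_shiftEnd_pow_compLeft_sub (hM : ∀ x : M, 2 • x = 0) (m u : ℕ) (hu : ¬ 2 ∣ u)
    (τ : M →ₗ[ℤ] M) (hτ : τ * τ = 1) {L J : ℕ} (hJm : J ≤ 2 ^ m) (hJL : J + 2 ^ (m + 1) ≤ L)
    (a' t₁ : Fin L → M)
    (hkey : (unipotentPow M L (2 ^ m * u) * τ.compLeft (Fin L) - 1) a' =
      -((unipotentPow M L (2 ^ m * u) - 1) ((unipotentPow M L (2 ^ m * u) - 1) t₁)))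
    (a₀ : ℕ) (v b : Fin J → M)
    (hcob : (fun i : Fin J => t₁ (Fin.castLE (le_trans (Nat.le_add_right J (2 ^ (m + 1))) hJL) i)) -
        (shiftEnd M J ^ a₀) v = τ.compLeft (Fin J) b - b) :
    (fun i : Fin J => -a' (Fin.castLE (le_trans (Nat.le_add_right J (2 ^ (m + 1))) hJL) i)) =
      (shiftEnd M J ^ a₀) (τ.compLeft (Fin J) v - v) := by
  rw [neg_castLE_eq_compLeft_sub_of_keyRelation hM m u hu τ hτ hJm hJL a' t₁ hkey]
  set T := τ.compLeft (Fin J) with hT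
  set t := (fun i : Fin J => t₁ (Fin.castLE (le_trans (Nat.le_add_right J (2 ^ (m + 1))) hJL) i)) with ht
  have ht' : t = (shiftEnd M J ^ a₀) v + (T - 1) b := by
    rw [LinearMap.sub_apply, Module.End.one_apply, ← hcob, add_sub_cancel]
  have hTS : T * shiftEnd M J ^ a₀ = shiftEnd M J ^ a₀ * T :=
    (Commute.pow_right (ZpExtension.shiftEnd_mul_compLeft τ).symm a₀).eq.symm ▸ rfl
  have hN0 : (T - 1) ((T - 1) b) = 0 := by
    rw [← Module.End.mul_apply, compLeft_sub_one_mul_self hM τ hτ, LinearMap.zero_apply]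
  calc T t - t = (T - 1) t := by rw [LinearMap.sub_apply, Module.End.one_apply]
    _ = (T - 1) ((shiftEnd M J ^ a₀) v) + (T - 1) ((T - 1) b) := by rw [ht', map_add]
    _ = (T - 1) ((shiftEnd M J ^ a₀) v) := by rw [hN0, add_zero]
    _ = (shiftEnd M J ^ a₀) ((T - 1) v) := by
        rw [← Module.End.mul_apply, ← Module.End.mul_apply, sub_mul, mul_sub, one_mul, mul_one, hTS]
    _ = (shiftEnd M J ^ a₀) (T v - v) := by rw [LinearMap.sub_apply, Module.End.one_apply]

end Summit.BirchSwinnertonDyer.BirchSwinnertonDyer.Theorems.SteinbergFibreAtTwo.KThree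

end
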